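import Literature.NumberTheory.EllipticCurves.ShintaniGenusSymbols
import Mathlib.Data.Nat.ChineseRemainder
import HarnessLib

/-!
# Symmetry of the genus weights: `ω_D = ω_{D'}` on forms of reduced discriminant `D D'`

An arithmetic brick for the explicit (Shintani-lift) route to Waldspurger's relation behind Tunnell's
theorem (`Literature.NumberTheory.EllipticCurves.Tunnell1983_a_sq_propto_L_one`, `…_b_sq_propto_L_one`; endgame
`TunnellWaldspurgerSymmetricFamilyProofs`): the endgame needs ONE symmetry of the coefficient matrix
of the family of twisted lifts, `a_{G_D}(D₀) = a_{G_{D₀}}(D)`, and both sides are the same weighted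
sum of cycle integrals over the lattice vectors `v` with `n(v) = D D₀` (`Shintani.nQ`) as soon as the
two GENUS WEIGHTS agree on those vectors. For the weights of `ShintaniGenusSymbols`
(`ω_D(v) = χ₋₄(v₂) ∏_{p ∣ D} Ω_p(v)`, `Ω_p = Shintani.coneSym`) we PROVE exactly this
(Gross–Kohnen–Zagier 1987, §I.2: "`χ_{D₁}(Q) = χ_{D₂}(Q)` if `Q` has discriminant `D₁ D₂`"):

* `prod_coneSym_eq_of_nQ_eq_mul` — for odd square-free `D, D'` with **`D ≡ D' (mod 4)`** and `v` with
  `v₂` odd and `n(v) = D D'`: `∏_{p ∣ D} Ω_p(v) = ∏_{p ∣ D'} Ω_p(v)`;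
* `genusWt_eq_of_nQ_eq_mul` — hence **`ω_D(v) = ω_{D'}(v)` whenever `n(v) = D D'`**, `D ≡ D' (mod 4)`
  (for `v₂` even both sides vanish). Coprimality of `D, D'` is NOT needed — which is what lets the
  endgame use the fixed auxiliary indices `D₀ = 1, 3, 5`.

The congruence `D ≡ D' (mod 4)` is necessary (e.g. `D = 1, D' = 3`, `v = (3, -3, 191)`:
`ω₁(v) = -1 ≠ 1 = ω₃(v)`); it is where quadratic reciprocity enters.

Proof. If some prime `p ∣ D D'` divides `v₀, v₁, v₂`, then `p² ∣ n(v) = D D'`, so `p` divides both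
`D` and `D'` and `Ω_p(v) = 0` kills both products. Otherwise `ι(v)(s, 1) = 64v₀s² + 128v₁s + v₂`
is not identically zero modulo any `p ∣ D D'` (at `s = 0, ±1` its values cannot all vanish), so by
the Chinese remainder theorem there is `s` with `r = ι(v)(s,1)` prime to `D D'`, and `r` is odd.
By Lemmas A/B of `ShintaniGenusSymbols` (`Ω_p(v)` is the Legendre symbol of any value of `ι(v)`
prime to `p`, `coneSym_eq_jacobiSym_binVal`) and multiplicativity, `∏_{p∣D} Ω_p(v) = (r/D)` and
`∏_{p∣D'} Ω_p(v) = (r/D')` (Jacobi symbols), whose product is `(r/DD')`. Now `DD' ≡ 1 (mod 4)`, so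
`(r/DD') = (|r|/DD') = (DD'/|r|)` (the sign is `χ₋₄(DD') = 1`; reciprocity), and
`(DD'/|r|) = (256·DD'/|r|) = (L²/|r|) = 1` with `L = 128(v₀s + v₁)`, because
`L² - 256 n(v) = 256 v₀ · r` (`disc ι(v) = 256 n(v)` is a square modulo the represented value `r`)
and `gcd(L, r) = 1` (a common prime would divide `256 DD'`). Hence `(r/D)(r/D') = 1` with
`(r/D') = ±1`, i.e. `(r/D) = (r/D')`.

No definitions, no named facts.

## References

* B. Gross, W. Kohnen, D. Zagier, *Heegner points and derivatives of L-series. II*, Math. Ann. 278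
  (1987) 497–562, §I.2, p. 508 (the genus character `χ_D(Q)` on forms of discriminant divisible by
  `D`; `χ_{D₁}(Q) = χ_{D₂}(Q)` for `disc Q = D₁D₂`).
* W. Kohnen, *Fourier coefficients of modular forms of half-integral weight*, Math. Ann. 271 (1985)
  237–268, §1, (5) (symmetry of `r_{k,N}(f; D, D')`).
* T. Shintani, Nagoya Math. J. 58 (1975), §2, Thm. 2. [Shintani1975]
-/

namespace Literature.NumberTheory.EllipticCurves.Shintani

open Finset

/-! ### `Ω_p` is the Legendre symbol of any represented value prime to `p` -/

section

variable {p : ℕ} [hp : Fact p.Prime]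

/-- **Lemmas A and B together**: for an odd prime `p ∣ n(v)` and any value `r = ι(v)(s,t)` prime to
`p`, `Ω_p(v) = (r/p)`. [cite: Shintani1975, §2] -/
theorem coneSym_eq_jacobiSym_binVal (hp2 : p ≠ 2) {v : Fin 3 → ℤ} (hn : (p : ℤ) ∣ nQ v) {s t : ℤ}
    (hval : ¬ (p : ℤ) ∣ binVal v s t) : coneSym p v = jacobiSym (binVal v s t) p := by
  unfold coneSym
  rw [if_pos hn]
  by_cases h0 : (p : ℤ) ∣ v 0
  · rw [if_pos h0]
    have hmod := binVal_modEq_of_dvd_zero hp2 hn h0 s t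
    have ht : ¬ (p : ℤ) ∣ t := by
      intro ht
      exact hval ((dvd_iff_of_modEq hmod).mpr (dvd_mul_of_dvd_right (dvd_pow ht two_ne_zero) _))
    rw [jacobiSym.mod_left' hmod, jacobiSym_mul_sq ht]
  · rw [if_neg h0, jacobiSym_binVal_of_not_dvd hp2 hn h0 hval]

end

/-! ### Products over the prime factors of a square-free number are Jacobi symbols -/

/-- `J(a | ∏_{p ∈ s} p) = ∏_{p ∈ s} J(a | p)` for a finite set of primes. [folklore] -/
theorem jacobiSym_prod_primes (a : ℤ) (s : Finset ℕ) (hs : ∀ p ∈ s, p.Prime) :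
    jacobiSym a (∏ p ∈ s, p) = ∏ p ∈ s, jacobiSym a p := by
  induction s using Finset.induction_on with
  | empty => simp [jacobiSym.one_right]
  | insert q s hq ih =>
    rw [prod_insert hq, prod_insert hq]
    have hq0 : q ≠ 0 := (hs q (mem_insert_self q s)).ne_zero
    have hs0 : ∏ p ∈ s, p ≠ 0 := prod_ne_zero_iff.mpr fun p hp' ↦ (hs p (mem_insert_of_mem hp')).ne_zero
    rw [jacobiSym.mul_right' a hq0 hs0, ih fun p hp' ↦ hs p (mem_insert_of_mem hp')]

/-- **`∏_{p ∣ D} Ω_p(v) = (r/D)`** for square-free odd `D ∣ n(v)` and a value `r = ι(v)(s,t)` prime to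
`D`. [cite: Shintani1975, §2] -/
theorem prod_coneSym_eq_jacobiSym {D : ℕ} (hD : Squarefree D) (hDodd : Odd D) {v : Fin 3 → ℤ}
    (hn : (D : ℤ) ∣ nQ v) {s t : ℤ} (hval : ∀ p ∈ D.primeFactors, ¬ (p : ℤ) ∣ binVal v s t) :
    ∏ p ∈ D.primeFactors, coneSym p v = jacobiSym (binVal v s t) D := by
  conv_rhs => rw [← Nat.prod_primeFactors_of_squarefree hD]
  rw [jacobiSym_prod_primes _ _ fun p hp ↦ Nat.prime_of_mem_primeFactors hp]
  refine prod_congr rfl fun p hp ↦ ?_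
  have hpp : p.Prime := Nat.prime_of_mem_primeFactors hp
  haveI : Fact p.Prime := ⟨hpp⟩
  have hp2 : p ≠ 2 := by
    rintro rfl
    exact (Nat.not_even_iff_odd.mpr hDodd) (even_iff_two_dvd.mpr (Nat.dvd_of_mem_primeFactors hp))
  have hpn : (p : ℤ) ∣ nQ v := (Int.natCast_dvd_natCast.mpr (Nat.dvd_of_mem_primeFactors hp)).trans hn
  exact coneSym_eq_jacobiSym_binVal hp2 hpn (hval p hp)

/-! ### A value of `ι(v)(·, 1)` prime to a given finite set of odd primes -/

/-- The values of `s ↦ ι(v)(s, 1)` at `s = 0, 1, -1` cannot all vanish modulo an odd prime `p`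
unless `p` divides `v₀, v₁, v₂`. [folklore] -/
theorem exists_binVal_not_dvd_of_prime {p : ℕ} (hp : p.Prime) (hp2 : p ≠ 2) {v : Fin 3 → ℤ}
    (hv : ¬ ((p : ℤ) ∣ v 0 ∧ (p : ℤ) ∣ v 1 ∧ (p : ℤ) ∣ v 2)) :
    ∃ s : ℤ, (s = 0 ∨ s = 1 ∨ s = -1) ∧ ¬ (p : ℤ) ∣ binVal v s 1 := by
  by_contra hcon
  simp only [not_exists, not_and, not_not] at hcon
  have h0 := hcon 0 (Or.inl rfl)
  have h1 := hcon 1 (Or.inr (Or.inl rfl))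
  have hm1 := hcon (-1) (Or.inr (Or.inr rfl))
  simp only [binVal] at h0 h1 hm1
  have hv2 : (p : ℤ) ∣ v 2 := by simpa using h0
  have hpI : Prime (p : ℤ) := Nat.prime_iff_prime_int.mp hp
  have hp2' : ¬ (p : ℤ) ∣ 2 := by
    intro h
    have : (p : ℤ) ≤ 2 := Int.le_of_dvd two_pos h
    have h2 : 2 ≤ p := hp.two_le
    omega
  have h128 : ¬ (p : ℤ) ∣ 128 := fun h ↦ hp2' (hpI.dvd_of_dvd_pow (show (p:ℤ) ∣ 2 ^ 7 by norm_num; exact h))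
  have h256 : ¬ (p : ℤ) ∣ 256 := fun h ↦ hp2' (hpI.dvd_of_dvd_pow (show (p:ℤ) ∣ 2 ^ 8 by norm_num; exact h))
  -- sum and difference of the values at `±1`
  have hsum : (p : ℤ) ∣ 128 * v 0 + 2 * v 2 := by
    have := dvd_add h1 hm1; ring_nf at this ⊢; exact this
  have hdiff : (p : ℤ) ∣ 256 * v 1 := by
    have := dvd_sub h1 hm1; ring_nf at this ⊢; exact this
  have hv0 : (p : ℤ) ∣ v 0 := by
    have : (p : ℤ) ∣ 128 * v 0 := by
      have := dvd_sub hsum (dvd_mul_of_dvd_right hv2 2); ring_nf at this ⊢; exact this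
    exact (hpI.dvd_or_dvd this).resolve_left h128
  have hv1 : (p : ℤ) ∣ v 1 := (hpI.dvd_or_dvd hdiff).resolve_left h256
  exact hv ⟨hv0, hv1, hv2⟩

/-- Polynomial congruence: `s ≡ s' (mod p)` implies `ι(v)(s,1) ≡ ι(v)(s',1) (mod p)`. [folklore] -/
theorem binVal_modEq_of_modEq {v : Fin 3 → ℤ} {n s s' : ℤ} (h : s ≡ s' [ZMOD n]) :
    binVal v s 1 ≡ binVal v s' 1 [ZMOD n] := by
  unfold binVal
  exact (((Int.ModEq.refl _).mul (h.pow 2)).add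
    ((((Int.ModEq.refl _).mul h)).mul (Int.ModEq.refl 1))).add (Int.ModEq.refl _)

/-- **A value prime to a finite set of odd primes** (Chinese remainder): if `ι(v)` is not identically
zero modulo any `p ∈ S`, there is `s` with `ι(v)(s,1)` prime to every `p ∈ S`. [folklore] -/
theorem exists_binVal_not_dvd (S : Finset ℕ) (hS : ∀ p ∈ S, p.Prime ∧ p ≠ 2) {v : Fin 3 → ℤ}
    (hv : ∀ p ∈ S, ¬ ((p : ℤ) ∣ v 0 ∧ (p : ℤ) ∣ v 1 ∧ (p : ℤ) ∣ v 2)) :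
    ∃ s : ℤ, ∀ p ∈ S, ¬ (p : ℤ) ∣ binVal v s 1 := by
  classical
  -- residues `a p ∈ {0, 1, p - 1}` with `p ∤ ι(v)(a p, 1)`
  have hchoice : ∀ p ∈ S, ∃ a : ℕ, ¬ (p : ℤ) ∣ binVal v a 1 := by
    intro p hp
    obtain ⟨s, hs, hval⟩ := exists_binVal_not_dvd_of_prime (hS p hp).1 (hS p hp).2 (hv p hp)
    rcases hs with rfl | rfl | rfl
    · exact ⟨0, by simpa using hval⟩
    · exact ⟨1, by simpa using hval⟩
    · refine ⟨p - 1, fun h ↦ hval ?_⟩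
      have hp1 : 1 ≤ p := (hS p hp).1.one_lt.le
      have hmod : ((p - 1 : ℕ) : ℤ) ≡ -1 [ZMOD p] := by
        rw [Int.modEq_iff_dvd]
        push_cast [Nat.cast_sub hp1]
        exact ⟨-1, by ring⟩
      exact (dvd_iff_of_modEq (binVal_modEq_of_modEq hmod)).mp h
  choose! a ha using hchoice
  have hs0 : ∀ p ∈ S, (id p : ℕ) ≠ 0 := fun p hp ↦ (hS p hp).1.ne_zero
  have hpp : Set.Pairwise (S : Set ℕ) (Function.onFun Nat.Coprime id) := by
    intro p hp q hq hpq
    exact (Nat.coprime_primes (hS p hp).1 (hS q hq).1).mpr hpq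
  obtain ⟨k, hk⟩ := Nat.chineseRemainderOfFinset a id S hs0 hpp
  refine ⟨k, fun p hp h ↦ ha p hp ?_⟩
  have hmod : ((k : ℕ) : ℤ) ≡ ((a p : ℕ) : ℤ) [ZMOD (p : ℕ)] := Int.natCast_modEq_iff.mpr (hk p hp)
  exact (dvd_iff_of_modEq (binVal_modEq_of_modEq hmod)).mp h

/-! ### The Jacobi-symbol identity behind the symmetry -/

/-- `J(256 | m) = 1` for odd `m`. [folklore] -/
theorem jacobiSym_256 {m : ℕ} (hm : Odd m) : jacobiSym 256 m = 1 := by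
  have h : (256 : ℤ) = 16 ^ 2 := by norm_num
  rw [h]
  apply jacobiSym.sq_one'
  -- `gcd(16, m) = 1`
  have : Nat.Coprime 16 m := by
    have h2 : Nat.Coprime 2 m := (Nat.coprime_two_left).mpr hm
    simpa using (Nat.Coprime.pow_left 4 h2)
  exact this

/-- **Reciprocity step**: for `r` odd, `N ≡ 1 (mod 4)`, `gcd(r, N) = 1` and `r ∣ L² - 256 N`
(`256 N` is a square modulo `r`, with a square root prime to `r`), `J(r | N) = 1`:
`(r/N) = (|r|/N) = (N/|r|) = (256N/|r|) = (L²/|r|) = 1`. [folklore] -/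
theorem jacobiSym_eq_one_of_dvd_sq_sub {r : ℤ} {N : ℕ} (hr : Odd r) (hN4 : N % 4 = 1)
    (hcop : r.gcd N = 1) {L : ℤ} (hL : r ∣ L ^ 2 - 256 * N) : jacobiSym r N = 1 := by
  set m : ℕ := r.natAbs with hm
  have hr0 : r ≠ 0 := by rintro rfl; exact (Int.not_even_iff_odd.mpr hr) ⟨0, by simp⟩
  have hmodd : Odd m := Int.natAbs_odd.mpr hr
  have hm0 : m ≠ 0 := Int.natAbs_ne_zero.mpr hr0
  -- Step 1: the sign of `r` does not matter since `χ₄(N) = 1`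
  have hNodd : Odd N := Nat.odd_iff.mpr (by omega)
  have h1 : jacobiSym r N = jacobiSym (m : ℤ) N := by
    rcases Int.natAbs_eq r with h | h
    · rw [← hm] at h; rw [← h]
    · rw [← hm] at h
      conv_lhs => rw [h]
      rw [jacobiSym.neg _ hNodd, ZMod.χ₄_nat_one_mod_four hN4]
      simp
  -- Step 2: reciprocity
  have h2 : jacobiSym (m : ℤ) N = jacobiSym (N : ℤ) m :=
    (jacobiSym.quadratic_reciprocity_one_mod_four hN4 hmodd).symm
  -- Step 3: insert the square `256`
  have h3 : jacobiSym (N : ℤ) m = jacobiSym (256 * N : ℤ) m := by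
    rw [jacobiSym.mul_left, jacobiSym_256 hmodd, one_mul]
  -- Step 4: `256 N ≡ L² (mod m)`
  have hmdvd : (m : ℤ) ∣ L ^ 2 - 256 * N := Int.natAbs_dvd.mpr hL
  have h4 : jacobiSym (256 * N : ℤ) m = jacobiSym (L ^ 2) m := by
    apply jacobiSym.mod_left'
    have : L ^ 2 ≡ 256 * N [ZMOD (m : ℕ)] := by
      rw [Int.modEq_iff_dvd]
      have : (m : ℤ) ∣ -(L ^ 2 - 256 * N) := (dvd_neg).mpr hmdvd
      simpa [neg_sub] using this
    exact this.symm
  -- Step 5: `gcd(L, m) = 1`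
  have h5 : jacobiSym (L ^ 2) m = 1 := by
    apply jacobiSym.sq_one'
    by_contra hg
    obtain ⟨q, hq, hqg⟩ := Nat.exists_prime_and_dvd hg
    have hqL : (q : ℤ) ∣ L := by
      have := Int.gcd_dvd_left L m
      exact (Int.natCast_dvd_natCast.mpr hqg).trans this
    have hqm : q ∣ m := by
      have h' : (q : ℤ) ∣ (m : ℤ) := (Int.natCast_dvd_natCast.mpr hqg).trans (Int.gcd_dvd_right L m)
      exact Int.natCast_dvd_natCast.mp h'
    have hqr : (q : ℤ) ∣ r := (Int.natCast_dvd_natCast.mpr hqm).trans (Int.natAbs_dvd.mpr dvd_rfl)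
    have hq256N : (q : ℤ) ∣ 256 * N := by
      have hA : (q : ℤ) ∣ L ^ 2 := dvd_pow hqL two_ne_zero
      have hB : (q : ℤ) ∣ L ^ 2 - 256 * N := hqr.trans hL
      have := dvd_sub hA hB
      simpa using this
    have hqI : Prime (q : ℤ) := Nat.prime_iff_prime_int.mp hq
    have hqodd : Odd q := hmodd.of_dvd_nat hqm
    have hq2 : ¬ (q : ℤ) ∣ 256 := by
      intro h
      have h2 : (q : ℤ) ∣ 2 := hqI.dvd_of_dvd_pow (show (q : ℤ) ∣ 2 ^ 8 by norm_num; exact h)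
      have : q ∣ 2 := Int.natCast_dvd_natCast.mp h2
      have := (Nat.prime_dvd_prime_iff_eq hq Nat.prime_two).mp this
      subst this
      exact (Nat.not_even_iff_odd.mpr hqodd) even_two
    have hqN : q ∣ N := Int.natCast_dvd_natCast.mp ((hqI.dvd_or_dvd hq256N).resolve_left hq2)
    have hq1 : q ∣ r.gcd N := Nat.dvd_gcd hqm hqN
    rw [hcop] at hq1
    exact hq.one_lt.ne' (Nat.dvd_one.mp hq1)
  rw [h1, h2, h3, h4, h5]

/-! ### The symmetry -/

/-- If a prime `p` divides `v₀, v₁, v₂` then `p² ∣ n(v)`. [folklore] -/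
theorem sq_dvd_nQ_of_dvd {p : ℤ} {v : Fin 3 → ℤ} (h0 : p ∣ v 0) (h1 : p ∣ v 1) (h2 : p ∣ v 2) :
    p ^ 2 ∣ nQ v := by
  unfold nQ
  have hA : p ^ 2 ∣ 64 * v 1 ^ 2 := dvd_mul_of_dvd_right (pow_dvd_pow_of_dvd h1 2) 64
  have hB : p ^ 2 ∣ v 0 * v 2 := by rw [sq]; exact mul_dvd_mul h0 h2
  exact dvd_sub hA hB

/-- For a prime `p` and square-free `D, D'`: `p² ∣ D D'` forces `p ∣ D` and `p ∣ D'`. [folklore] -/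
theorem dvd_and_dvd_of_sq_dvd_mul {p D D' : ℕ} (hp : p.Prime) (hD : Squarefree D) (hD' : Squarefree D')
    (h : p ^ 2 ∣ D * D') : p ∣ D ∧ p ∣ D' := by
  have hpD : ¬ p ^ 2 ∣ D := fun h2 ↦ hp.one_lt.ne' (by
    have := hD p (by rw [← sq]; exact h2); exact Nat.isUnit_iff.mp this)
  have hpD' : ¬ p ^ 2 ∣ D' := fun h2 ↦ hp.one_lt.ne' (by
    have := hD' p (by rw [← sq]; exact h2); exact Nat.isUnit_iff.mp this)
  have hpp : p ∣ D * D' := (dvd_pow_self p two_ne_zero).trans h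
  rcases (Nat.Prime.dvd_mul hp).mp hpp with hD1 | hD1'
  · refine ⟨hD1, ?_⟩
    by_contra hnd
    -- `p² ∣ D D'` with `p ∤ D'` gives `p² ∣ D`
    have hcop : Nat.Coprime (p ^ 2) D' := (Nat.Coprime.pow_left 2 ((Nat.Prime.coprime_iff_not_dvd hp).mpr hnd))
    exact hpD (hcop.dvd_of_dvd_mul_right h)
  · refine ⟨?_, hD1'⟩
    by_contra hnd
    have hcop : Nat.Coprime (p ^ 2) D := (Nat.Coprime.pow_left 2 ((Nat.Prime.coprime_iff_not_dvd hp).mpr hnd))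
    exact hpD' (hcop.dvd_of_dvd_mul_left h)

/-- **Symmetry of the products of local genus symbols**: for odd square-free `D ≡ D' (mod 4)` and `v`
with `v₂` odd and `n(v) = D D'`, `∏_{p ∣ D} Ω_p(v) = ∏_{p ∣ D'} Ω_p(v)` (Gross–Kohnen–Zagier II, §I.2:
`χ_{D₁}(Q) = χ_{D₂}(Q)` on forms of discriminant `D₁D₂`; no coprimality needed). [cite: Shintani1975, §2, Thm. 2] -/
theorem prod_coneSym_eq_of_nQ_eq_mul {D D' : ℕ} (hD : Squarefree D) (hD' : Squarefree D')
    (hDodd : Odd D) (hD'odd : Odd D') (hmod : D % 4 = D' % 4) {v : Fin 3 → ℤ} (hv2 : Odd (v 2))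
    (hn : nQ v = D * D') :
    ∏ p ∈ D.primeFactors, coneSym p v = ∏ p ∈ D'.primeFactors, coneSym p v := by
  classical
  have hD0 : D ≠ 0 := hD.ne_zero
  have hD'0 : D' ≠ 0 := hD'.ne_zero
  have hDn : (D : ℤ) ∣ nQ v := ⟨D', by rw [hn]⟩
  have hD'n : (D' : ℤ) ∣ nQ v := ⟨D, by rw [hn]; ring⟩
  by_cases hdeg : ∃ p ∈ (D * D').primeFactors, (p : ℤ) ∣ v 0 ∧ (p : ℤ) ∣ v 1 ∧ (p : ℤ) ∣ v 2
  · -- degenerate case: `p² ∣ D D'`, so `p ∣ D`, `p ∣ D'` and `Ω_p(v) = 0` on both sides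
    obtain ⟨p, hp, h0, h1, h2⟩ := hdeg
    have hpp : p.Prime := Nat.prime_of_mem_primeFactors hp
    haveI : Fact p.Prime := ⟨hpp⟩
    have hsq : (p : ℤ) ^ 2 ∣ nQ v := sq_dvd_nQ_of_dvd h0 h1 h2
    rw [hn] at hsq
    have hsq' : p ^ 2 ∣ D * D' := by exact_mod_cast hsq
    obtain ⟨hpD, hpD'⟩ := dvd_and_dvd_of_sq_dvd_mul hpp hD hD' hsq'
    have hcone : coneSym p v = 0 := by
      unfold coneSym
      rw [if_pos ((Int.natCast_dvd_natCast.mpr hpD).trans hDn), if_pos h0]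
      exact jacobiSym_eq_zero_of_dvd h2
    rw [prod_eq_zero (Nat.mem_primeFactors.mpr ⟨hpp, hpD, hD0⟩) hcone,
      prod_eq_zero (Nat.mem_primeFactors.mpr ⟨hpp, hpD', hD'0⟩) hcone]
  · -- generic case: a value `r = ι(v)(s,1)` prime to `D D'`
    push Not at hdeg
    have hS : ∀ p ∈ (D * D').primeFactors, p.Prime ∧ p ≠ 2 := fun p hp ↦ by
      refine ⟨Nat.prime_of_mem_primeFactors hp, ?_⟩
      rintro rfl
      have h2 : 2 ∣ D * D' := Nat.dvd_of_mem_primeFactors hp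
      exact (Nat.not_even_iff_odd.mpr (hDodd.mul hD'odd)) (even_iff_two_dvd.mpr h2)
    obtain ⟨s, hs⟩ := exists_binVal_not_dvd _ hS (fun p hp h ↦ hdeg p hp h.1 h.2.1 h.2.2)
    set r : ℤ := binVal v s 1 with hr
    have hsD : ∀ p ∈ D.primeFactors, ¬ (p : ℤ) ∣ r := fun p hp ↦
      hs p (Nat.mem_primeFactors.mpr ⟨Nat.prime_of_mem_primeFactors hp,
        (Nat.dvd_of_mem_primeFactors hp).mul_right D', mul_ne_zero hD0 hD'0⟩)
    have hsD' : ∀ p ∈ D'.primeFactors, ¬ (p : ℤ) ∣ r := fun p hp ↦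
      hs p (Nat.mem_primeFactors.mpr ⟨Nat.prime_of_mem_primeFactors hp,
        (Nat.dvd_of_mem_primeFactors hp).mul_left D, mul_ne_zero hD0 hD'0⟩)
    rw [prod_coneSym_eq_jacobiSym hD hDodd hDn hsD, prod_coneSym_eq_jacobiSym hD' hD'odd hD'n hsD']
    -- `r` is odd and prime to `D D'`
    have hrodd : Odd r := by
      rw [hr, binVal]
      have : 64 * v 0 * s ^ 2 + 128 * v 1 * s * 1 + v 2 * 1 ^ 2 = 2 * (32 * v 0 * s ^ 2 + 64 * v 1 * s) + v 2 := by
        ring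
      rw [this]
      exact (even_two_mul _).add_odd hv2
    have hcopDD' : r.gcd ((D * D' : ℕ) : ℤ) = 1 := by
      by_contra hg
      obtain ⟨q, hq, hqg⟩ := Nat.exists_prime_and_dvd hg
      have hqr : (q : ℤ) ∣ r := by
        have := Int.gcd_dvd_left r ((D * D' : ℕ) : ℤ)
        exact (Int.natCast_dvd_natCast.mpr hqg).trans this
      have hqDD' : q ∣ D * D' := by
        have := Int.gcd_dvd_right r ((D * D' : ℕ) : ℤ)
        exact Int.natCast_dvd_natCast.mp ((Int.natCast_dvd_natCast.mpr hqg).trans this)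
      exact hs q (Nat.mem_primeFactors.mpr ⟨hq, hqDD', mul_ne_zero hD0 hD'0⟩) hqr
    -- the product `(r/D)(r/D') = (r/DD') = 1`
    have hprod : jacobiSym r D * jacobiSym r D' = 1 := by
      rw [← jacobiSym.mul_right' r hD0 hD'0]
      have hN4 : (D * D') % 4 = 1 := by
        have hD4 : D % 4 = 1 ∨ D % 4 = 3 := by have := Nat.odd_iff.mp hDodd; omega
        rcases hD4 with h | h
        · have h' : D' % 4 = 1 := by omega
          rw [Nat.mul_mod, h, h']
        · have h' : D' % 4 = 3 := by omega
          rw [Nat.mul_mod, h, h']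
      refine jacobiSym_eq_one_of_dvd_sq_sub hrodd hN4 hcopDD' (L := 128 * (v 0 * s + v 1)) ?_
      -- `L² - 256 n(v) = 256 v₀ · r`
      refine ⟨256 * v 0, ?_⟩
      push_cast
      rw [← hn, hr, binVal, nQ]
      ring
    -- `(r/D') = ±1`, hence `(r/D) = (r/D')`
    have hcopD' : r.gcd D' = 1 := by
      have h := Int.gcd_dvd_gcd_mul_left_right r (D' : ℤ) (D : ℤ)
      have e : (D : ℤ) * (D' : ℤ) = ((D * D' : ℕ) : ℤ) := by push_cast; ring
      rw [e, hcopDD'] at h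
      exact Nat.dvd_one.mp h
    rcases jacobiSym.eq_one_or_neg_one hcopD' with h | h <;> rw [h] at hprod ⊢ <;> linarith

/-- **Symmetry of the genus weights**: for odd square-free `D ≡ D' (mod 4)` and every `v` with
`n(v) = D D'`, `ω_D(v) = ω_{D'}(v)`. [cite: Shintani1975, §2, Thm. 2] -/
theorem genusWt_eq_of_nQ_eq_mul {D D' : ℕ} (hD : Squarefree D) (hD' : Squarefree D')
    (hDodd : Odd D) (hD'odd : Odd D') (hmod : D % 4 = D' % 4) {v : Fin 3 → ℤ}
    (hn : nQ v = D * D') : genusWt D v = genusWt D' v := by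
  unfold genusWt
  by_cases hv2 : Odd (v 2)
  · rw [prod_coneSym_eq_of_nQ_eq_mul hD hD' hDodd hD'odd hmod hv2 hn]
  · have : (ZMod.χ₄ (v 2) : ℤ) = 0 := by
      rw [ZMod.χ₄_int_eq_if_mod_four]
      have : v 2 % 2 = 0 := Int.even_iff.mp (Int.not_odd_iff_even.mp hv2)
      rw [if_pos this]
    rw [this, zero_mul, zero_mul]

end Literature.NumberTheory.EllipticCurves.Shintani
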